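import Summits.BirchSwinnertonDyer.Rank1Residual.X2.GreenbergVatsalCaseOne
import HarnessLib

/-!
# Class X2a, GV CASE 1: the two remaining PRINTED inputs of the flag `GV00-mult-asserted`, TYPED
# (`X2.GVLiftingInput` = GV p. 28/30; `X2.GVAnalyticInput` = GV §3 Thm. (3.11) + (28) + p. 43), and
# CASE 1 of `lambda_muAnal_multiplicative_of_gvPar` from them
# (cell `b2b-bsdres`, unit `b2b-bsdres-eisenstein-p2`, gen 17)

HONEST FRAMING (run/shared/lean/b2b/bsd-rank1-residual/, verbatim in every file): the goal of the
cell is to DELETE the COMBINATION-SHAPED residual classes of the Birch–Swinnerton-Dyer formula for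
ALL analytic-rank `≤ 1` elliptic curves over `ℚ` — "full BSD formula for every rank `≤ 1` curve in
class `C`" assembled STRICTLY from published theorems — so that the rank-`≤ 1` remainder becomes
exactly the CONSTRUCTION-SHAPED classes, which are TYPED (missing-input `Prop`s), NOT attempted.
This is not "finishing BSD". Research route; NO CLAIM BEYOND STATED CLASSES; nothing here changes
a label. TWO TYPED INPUTS (`def … : Prop` with bodies; per-datum statements; NOTHING ASSERTED) and
one theorem; no named fact.

WHY (X2-GAP §22.3/§22.7). Gen 17's `GreenbergVatsalCaseOne.caseOne_clause_of_shapes` derives CASE 1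
(rational line ramified at `p` and even) of the flag's named fact
`GreenbergVatsal2000.lambda_muAnal_multiplicative_of_gvPar` from the cell's registered facts plus two
hypotheses whose types are written out inline. This file NAMES those two types, per datum, so that
the Partition / CLASS-OWNERS bookkeeping, the referee and the lit seat can refer to them, and so
that a future Literature reading-fact (which must be phrased in Literature vocabulary, X2-GAP
§22.7) or a per-pair certificate can be shown to imply them:

* `GVLiftingInput W p κ S₀ Φ₀ hΦ` — GV p. 28: the exact sequence
  `0 → H¹(ℚ_Σ/ℚ_∞, Φ) → H¹(ℚ_Σ/ℚ_∞, E[p]) → H¹(ℚ_Σ/ℚ_∞, Ψ) → 0` (surjectivity on the right, from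
  p. 30 "`H²(ℚ_Σ/ℚ_∞, Φ) = 0`": Ferrero–Washington, Prop. (2.5), [Gre99] Prop. 4), in the
  operational form gen 16's devissage consumes: every class of `S^{Σ₀}_{E[p]/Φ₀}(ℚ_∞)` lifts to a
  class of `H¹(ℚ_Σ/ℚ_∞, E[p])`.
* `GVAnalyticInput W p κ f S₀ Φ₀ hΦ` — GV §3 at `χ = 1`: Thm. (3.11)
  (`L_{Σ₀}(E/ℚ,T) ≡ u·L(G,T) (mod π)`; proof covers `p ∣ M`, p. 43), (28)
  (`L(G,T) = L_{Σ₀}(C,T)·L_{Σ₀}(D,T)`, each factor with `μ = 0` by Ferrero–Washington) and p. 43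
  ("the `λ`-invariant of `L(G,T)` is equal to `λ_{φ,Σ₀} + λ_{ψ,Σ₀}`. The two terms are the `O`-coranks
  of `S^{Σ₀}_C(ℚ_∞)` and `S^{Σ₀}_D(ℚ_∞)`") with pp. 28–29 (Props. (2.6)/(2.8): those coranks are
  `dim H¹(ℚ_Σ/ℚ_∞, Φ)` and `dim S^{Σ₀}_Ψ(ℚ_∞)`): for every `ϖ` with `ϖ·Ω_E = Ω⁺_f`, THE multiplicative
  `p`-adic `L`-function `L` and every `b ∈ Λ` with `ι b = ϖ·L`: `b·∏_{ℓ∈Σ₀}𝒫_ℓ` has unit content and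
  `p^{ord_T(b·∏𝒫 mod p)} = #H¹(ℚ_Σ/ℚ_∞, Φ₀) · #S^{Σ₀}_{E[p]/Φ₀}(ℚ_∞)`.
* `caseOne_clause_of_inputs`: registered facts + (`GVLiftingInput`, `GVAnalyticInput` at every
  admissible datum) ⟹ the body of `lambda_muAnal_multiplicative_of_gvPar` for a ramified-even line
  (= `caseOne_clause_of_shapes`, by unfolding).

References: [GreenbergVatsal2000] §2 pp. 28–30; §3 Thm. (3.11), (28), p. 43;
HOME/b2b-bsdres-eisenstein-p2/X2-GAP.md §22.
-/

set_option autoImplicit false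

noncomputable section

open scoped Classical AddSubgroup MatrixGroups ModularForm

open PowerSeries NumberField IsDedekindDomain Field WeierstrassCurve CongruenceSubgroup
  Literature.NumberTheory.EllipticCurves Literature.NumberTheory.EllipticCurves.GreenbergVatsal2000
  Literature.NumberTheory.EllipticCurves.ModularForms
  Literature.NumberTheory.EllipticCurves.Rank1Residual
  Summit.BirchSwinnertonDyer.Rank1Residual.X2.GreenbergVatsalCaseOne

namespace Summit.BirchSwinnertonDyer.Rank1Residual.X2

/-- **`GVLiftingInput` (TYPED; nothing asserted)** — GV p. 28, the exact sequence
`0 → H¹(ℚ_Σ/ℚ_∞, Φ) → H¹(ℚ_Σ/ℚ_∞, E[p]) → H¹(ℚ_Σ/ℚ_∞, Ψ) → 0` (right exactness from p. 30: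
"`H²(ℚ_Σ/ℚ_∞, Φ) = 0`"), as the lifting property of gen 16's devissage for the datum
`(E, p, ℚ_∞ = ℚ̄^{ker κ}, Σ₀, Φ₀)`: every class of `S^{Σ₀}_{E[p]/Φ₀}(ℚ_∞)`
(`ResidualDevissageSelmer.quotSelmer`) is the image of a class of `H¹(ℚ_Σ/ℚ_∞, E[p])`
(`GreenbergVatsal2000.unramifiedOutside` of `E[p^∞][p]`). A per-datum `Prop`; character-theoretic
in content (Ferrero–Washington); not a theorem of the tree.
[cite: GreenbergVatsal2000, §2 p. 28 (exact sequence) and p. 30 (H² = 0) (shape only; nothing asserted)] -/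
def GVLiftingInput (W : WeierstrassCurve ℚ) [W.IsGloballyMinimal] [W.IsElliptic] (p : ℕ)
    [Fact p.Prime] (κ : ZpExtension ℚ p) (S₀ : Finset (HeightOneSpectrum (𝓞 ℚ)))
    (Φ₀ : AddSubgroup (W.geomTorsion (p : ℤ))) (hΦ : IsRationalLine W p Φ₀) : Prop :=
  ∀ s ∈ ResidualDevissageSelmer.quotSelmer κ.kerSubgroup
      (ResidualDevissageLine.lineSub Φ₀ hΦ).Quot p (↑S₀ : Set (HeightOneSpectrum (𝓞 ℚ))),
    ∃ x ∈ GreenbergVatsal2000.unramifiedOutside κ.kerSubgroup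
        ↥((↥(W.geomPrimaryTorsion p))[(p : ℤ)]) p (↑S₀ : Set (HeightOneSpectrum (𝓞 ℚ))),
      ResidualDevissageSelmer.subH1 κ.kerSubgroup (ResidualDevissageLine.lineSub Φ₀ hΦ).proj
        (ResidualDevissageLine.lineSub Φ₀ hΦ).proj_smul x = s

/-- **`GVAnalyticInput` (TYPED; nothing asserted)** — GV §3 at `χ = 1` for the datum
`(E, p, ℚ_∞, f, Σ₀, Φ₀)`: for every `ϖ` with `ϖ·Ω_E = Ω⁺_f`, THE multiplicative `p`-adic
`L`-function `L` of `f` (split: `IsSplitMultPAdicLFunctionOf`; non-split: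
`IsMultPAdicLFunctionOf f p (−1)`) and every `b ∈ Λ` with `ι b = ϖ·L`, the non-primitive element
`b · ∏_{ℓ∈Σ₀} 𝒫_ℓ(T)` (`= ϖ · L_{Σ₀}(E/ℚ,T)` under `ι`) has unit content (`μ(L_{Σ₀}) = 0`: Thm. (3.11)
+ (28) + Ferrero–Washington) and `p^{ord_T(b·∏𝒫 mod p)} = #H¹(ℚ_Σ/ℚ_∞, Φ₀) · #S^{Σ₀}_{E[p]/Φ₀}(ℚ_∞)`
(`λ(L_{Σ₀}(E)) = λ(L(G)) = λ_{φ,Σ₀} + λ_{ψ,Σ₀}` = the residual dimensions: Thm. (3.11), (28), p. 43,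
pp. 28–29). A per-datum `Prop`; not a theorem of the tree.
[cite: GreenbergVatsal2000, §3 Thm. (3.11), (28), p. 43; §2 pp. 28–29 (shape only; nothing asserted)] -/
def GVAnalyticInput (W : WeierstrassCurve ℚ) [W.IsGloballyMinimal] [W.IsElliptic] (p : ℕ)
    [Fact p.Prime] (κ : ZpExtension ℚ p) {N : ℕ} [NeZero N] (f : CuspForm (Gamma0 N) 2)
    (S₀ : Finset (HeightOneSpectrum (𝓞 ℚ))) (Φ₀ : AddSubgroup (W.geomTorsion (p : ℤ)))
    (hΦ : IsRationalLine W p Φ₀) : Prop :=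
  ∀ (ϖ : ℚ), (ϖ : ℝ) * W.realPeriodRat = plusPeriod f →
  ∀ (L : PowerSeries ℚ_[p]),
    (W.HasSplitMultiplicativeReductionAtPrime p → IsSplitMultPAdicLFunctionOf f p L) →
    (¬ W.HasSplitMultiplicativeReductionAtPrime p → IsMultPAdicLFunctionOf f p (-1) L) →
  ∀ (b : IwasawaAlgebra p),
    iwasawaToPowerSeries p b = PowerSeries.C ((ϖ : ℚ) : ℚ_[p]) * L →
    HasUnitContent (b * eulerFactorProduct W p S₀) ∧
      p ^ (PowerSeries.map (PadicInt.toZMod (p := p)) (b * eulerFactorProduct W p S₀)).order.toNat =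
        Nat.card (GreenbergVatsal2000.unramifiedOutside κ.kerSubgroup
            (ResidualDevissageLine.lineSub Φ₀ hΦ).Sub p (↑S₀ : Set (HeightOneSpectrum (𝓞 ℚ)))) *
          Nat.card (ResidualDevissageSelmer.quotSelmer κ.kerSubgroup
            (ResidualDevissageLine.lineSub Φ₀ hΦ).Quot p (↑S₀ : Set (HeightOneSpectrum (𝓞 ℚ))))

/-- **CASE 1 of the flag's named fact from the registered facts and the two TYPED inputs** (at
every admissible datum: `p` odd; `κ` cyclotomic; `Φ₀` a rational line ramified at `p` and even;
`Σ₀ ∌ p` finite containing the bad places `≠ p`; for the analytic input also `p ‖ N` and `f` the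
newform). Conclusion: the body of `GreenbergVatsal2000.lambda_muAnal_multiplicative_of_gvPar` for
`(W, p, κ, γ, f, D, ϖ, f_E)` with `GVPar` replaced by its first case — by
`GreenbergVatsalCaseOne.caseOne_clause_of_shapes` (the inputs are its `hLift`/`hAn` by definition). -/
theorem caseOne_clause_of_inputs
    (hT : Silverman1994_thmV53_tateUniformisation.{0})
    (hT' : Silverman1994_thmV53_corV54_tateUniformisation.{0})
    (hA : lambda_nonPrimitive_eq_add_sum_delta_multiplicative)
    (hB : datumSelmer_divisible_of_finite_torsionBy)
    (hF : datumStrictSelmer_lt_datumSelmer_of_split)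
    (hG : Greenberg1999.prop510_isTorsion_hasUnitContent_of_gvPar)
    (hLift : ∀ (W : WeierstrassCurve ℚ) [W.IsGloballyMinimal] [W.IsElliptic] (p : ℕ) [Fact p.Prime]
      (κ : ZpExtension ℚ p) (S₀ : Finset (HeightOneSpectrum (𝓞 ℚ)))
      (Φ₀ : AddSubgroup (W.geomTorsion (p : ℤ))) (hΦ : IsRationalLine W p Φ₀),
      p ≠ 2 → κ.IsCyclotomic → ¬ LineUnramifiedAt W p Φ₀ → LineEven W p Φ₀ →
      (∀ v ∈ S₀, ((p : ℕ) : 𝓞 ℚ) ∉ v.asIdeal) →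
      (∀ v : HeightOneSpectrum (𝓞 ℚ), v ∉ S₀ → ((p : ℕ) : 𝓞 ℚ) ∉ v.asIdeal →
        W.HasGoodReductionAt v) →
      GVLiftingInput W p κ S₀ Φ₀ hΦ)
    (hAn : ∀ (W : WeierstrassCurve ℚ) [W.IsGloballyMinimal] [W.IsElliptic] (p : ℕ) [Fact p.Prime]
      (κ : ZpExtension ℚ p) {N : ℕ} [NeZero N] (f : CuspForm (Gamma0 N) 2)
      (S₀ : Finset (HeightOneSpectrum (𝓞 ℚ)))
      (Φ₀ : AddSubgroup (W.geomTorsion (p : ℤ))) (hΦ : IsRationalLine W p Φ₀),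
      p ≠ 2 → W.HasMultiplicativeReductionAtPrime p → κ.IsCyclotomic →
      ¬ LineUnramifiedAt W p Φ₀ → LineEven W p Φ₀ → IsNewformOf W f →
      (∀ v ∈ S₀, ((p : ℕ) : 𝓞 ℚ) ∉ v.asIdeal) →
      (∀ v : HeightOneSpectrum (𝓞 ℚ), v ∉ S₀ → ((p : ℕ) : 𝓞 ℚ) ∉ v.asIdeal →
        W.HasGoodReductionAt v) →
      GVAnalyticInput W p κ f S₀ Φ₀ hΦ)
    (W : WeierstrassCurve ℚ) [W.IsElliptic] [W.IsGloballyMinimal] (p : ℕ) [Fact p.Prime]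
    {κ : ZpExtension ℚ p} {γ : absoluteGaloisGroup ℚ} {N : ℕ} [NeZero N]
    {f : CuspForm (Gamma0 N) 2}
    (hp : p ≠ 2) (hmult : W.HasMultiplicativeReductionAtPrime p)
    {Φ₀ : AddSubgroup (W.geomTorsion (p : ℤ))} (hΦ : IsRationalLine W p Φ₀)
    (hram : ¬ LineUnramifiedAt W p Φ₀) (heven : LineEven W p Φ₀)
    (hκ : κ.IsCyclotomic) (hγ : κ.IsTopGenerator γ) (hf : IsNewformOf W f)
    (D : W.SelmerDualData κ γ) (ϖ : ℚ) (hϖ : (ϖ : ℝ) * W.realPeriodRat = plusPeriod f)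
    (fE : IwasawaAlgebra p) (hchar : D.charIdeal = Ideal.span {fE}) :
    (W.HasSplitMultiplicativeReductionAtPrime p →
        ∀ (L : PowerSeries ℚ_[p]), IsSplitMultPAdicLFunctionOf f p L →
        ∀ (b : IwasawaAlgebra p), iwasawaToPowerSeries p b = PowerSeries.C ((ϖ : ℚ) : ℚ_[p]) * L →
          HasUnitContent b ∧
            (PowerSeries.map (PadicInt.toZMod (p := p)) b).order =
              (PowerSeries.map (PadicInt.toZMod (p := p)) (PowerSeries.X * fE)).order) ∧
      (¬ W.HasSplitMultiplicativeReductionAtPrime p →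
        ∀ (L : PowerSeries ℚ_[p]), IsMultPAdicLFunctionOf f p (-1) L →
        ∀ (b : IwasawaAlgebra p), iwasawaToPowerSeries p b = PowerSeries.C ((ϖ : ℚ) : ℚ_[p]) * L →
          HasUnitContent b ∧
            (PowerSeries.map (PadicInt.toZMod (p := p)) b).order =
              (PowerSeries.map (PadicInt.toZMod (p := p)) fE).order) :=
  caseOne_clause_of_shapes hT hT' hA hB hF hG
    (fun W _ _ p _ κ S₀ Φ₀ hΦ hp hκ hram heven hS₀ hS =>
      hLift W p κ S₀ Φ₀ hΦ hp hκ hram heven hS₀ hS)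
    (fun W _ _ p _ κ _ _ f S₀ Φ₀ hΦ hp hmult hκ hram heven hf hS₀ hS =>
      hAn W p κ f S₀ Φ₀ hΦ hp hmult hκ hram heven hf hS₀ hS)
    W p hp hmult hΦ hram heven hκ hγ hf D ϖ hϖ fE hchar

end Summit.BirchSwinnertonDyer.Rank1Residual.X2

end
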